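import Summits.HodgeConjecture.CorCM.GaloisQuaternionEightCyclicThirteenLift
import Summits.HodgeConjecture.CorCM.GaloisThirtyTwoDividesStructure
import HarnessLib

/-!
# THE SHAPES Q× AND QK ARE BAD FOR `p ∈ {3, 5, 7, 11, 13}`: GOOD Galois CM fields of degree `2ⁿ·p` (`n ≥ 5`) with these `p`
# have `Gal(K/ℚ) = C_p ⋊ C_{2ⁿ}` (shape C(r)) or `Gal(K/ℚ) ≅ Dic` (quaternion Sylow, `a` central, `x` inverting)

COR-CM (cell `pub-hodgecm2`), binder seat b04 (gen 39), count-neutral own lane «Galois-CM-type classification».  KERNEL ONLY: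
theorems; no definition, no named fact, no `sorry`.  `HC_CM` is neither used nor claimed.

Gen 38 (`CorCM/GaloisOddPrimeShapes`, `…NormalShapes`) and gen 39 (`CorCM/GaloisThirtyTwoDividesStructure`): a GOOD Galois CM
field of degree `2ⁿ·p` (`p` odd prime, `n ≥ 5`) has `Gal(K/ℚ) = ⟨u⟩ ⋊ S`, `S` a Sylow `2`-subgroup, cyclic (shape C(r)) or
generalised quaternion `⟨a, x⟩` acting on `u` through `±1` in one of three ways: Q× (`a, x` centralise `u`: `Q_{2ⁿ} × C_p`), Dic
(`a` centralises, `x` inverts), QK (`a` inverts, `x` centralises).  In the shapes Q× and QK the subgroup `⟨a^{2ⁿ⁻³}, x⟩ × ⟨u⟩ ≅ Q₈ × C_p`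
(`n ≥ 4`; resp. `⟨a^{2ⁿ⁻⁴}, x⟩ × ⟨u⟩ ≅ Q₁₆ × C_p`, `n ≥ 5`) contains complex conjugation `c = a^{2ⁿ⁻²}` as its central involution and
`⟨u⟩ ◁ Gal(K/ℚ)`, so gen 39's certificate lift (`CorCM/GaloisQuaternionCyclicLift`) applies: **Q× and QK are BAD for `p = 3, 5, 11, 13`
(certificates of `Q₈ × C_p`; the one for `p = 13` is new, `CorCM/GaloisQuaternionEightCyclicThirteenLift`) and for `p = 7`
(certificate of `Q₁₆ × C₇`; `Q₈ × C₇` is GOOD).**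

* §1 `conj_pow_eq_inv_of_mul_eq` (`x a = a⁻¹ x ⟹ x aᵏ x⁻¹ = (aᵏ)⁻¹`), `pow_two_mul_comm_of_conj_eq_inv`
  (`a u a⁻¹ = u⁻¹ ⟹ a^{2j} u = u a^{2j}`).
* §2 **`exists_simple_degenerate_of_shape_quaternion_of_prime_le_thirteen`** (`p ∈ {3,5,11,13}`, `n ≥ 4`, shapes Q×/QK ⟹ BAD),
  **`exists_simple_degenerate_of_shape_quaternion_seven`** (`p = 7`, `n ≥ 5`), and the parametrised reduction
  **`exists_simple_degenerate_of_shape_quaternion_of_certificate`** (any odd `p`: Q×/QK are BAD as soon as `Q₈ × C_p` carries a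
  balanced certificate balanced over `C_p`).
* §3 **`structure_of_forall_isNondegenerate_of_thirtytwo_dvd_of_prime_le_thirteen`**: `[K:ℚ] = 2ⁿ·p`, `p ∈ {3, 5, 7, 11, 13}`, `n ≥ 5`,
  `K` GOOD ⟹ `c` is the unique involution and for every Sylow `2`-subgroup `S` (order `2ⁿ`): EITHER `S = ⟨x⟩` cyclic,
  `Gal = ⟨u⟩ ⋊ ⟨x⟩`, `x u x⁻¹ = uʳ` (shape C(r)), OR `S = ⟨a, x⟩` generalised quaternion with `a u a⁻¹ = u`, `x u x⁻¹ = u⁻¹` (shape Dic,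
  `Gal ≅ Dic_{2ⁿ⁻²p}`, for which HC holds for all powers of all abelian varieties with CM by `K`, gen 38
  `hodgeConjectureFor_pow_of_shape_dic`).

## References

* [Shimura1998] G. Shimura, *Abelian Varieties with Complex Multiplication and Modular Functions*, §6.2 Thm. 3, §8.2 Prop. 26, §32.10.
* [Gordon1999HodgeAVSurvey] B. B. Gordon, *A survey of the Hodge conjecture for abelian varieties*, Thm. 6.4, §9.3.
* [Dodson1984] B. Dodson, *The structure of Galois groups of CM-fields*, Trans. AMS 283 (1984), §3.1.1, §4.1, §5.
* [Rotman1995] J. J. Rotman, *An Introduction to the Theory of Groups*, 4th ed., GTM 148, Thm. 4.12, Thm. 5.46, Thm. 7.41.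
-/

noncomputable section

open CategoryTheory CategoryTheory.Limits NumberField
open scoped BigOperators

namespace Summit.HodgeConjecture.CorCM.GaloisModels

open Literature.NumberTheory.ComplexMultiplication
open Literature.AlgebraicGeometry.Motives (AbelianVariety CMType)
open Literature.AlgebraicGeometry.HodgeTheory
open Literature.AlgebraicGeometry.ComplexMultiplication (IsCMTypeRealisation)
open Literature.AlgebraicGeometry.Pohlmann1968
open Literature.Barriers.HodgeConjecture (divisorClassesSpan)
open Summit.HodgeConjecture.CorCM.GaloisRank

/-! ## §1 Two group-theoretic identities -/

section GroupLemmas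

variable {G : Type*} [Group G]

/-- `x a = a⁻¹ x ⟹ x aᵏ x⁻¹ = (aᵏ)⁻¹`. [folklore] -/
theorem conj_pow_eq_inv_of_mul_eq {a x : G} (hxa : x * a = a⁻¹ * x) (k : ℕ) : x * a ^ k * x⁻¹ = (a ^ k)⁻¹ := by
  have h1 : x * a * x⁻¹ = a⁻¹ := by rw [hxa, mul_inv_cancel_right]
  rw [← MulAut.conj_apply, map_pow, MulAut.conj_apply, h1, inv_pow]

/-- `a u a⁻¹ = u⁻¹ ⟹ a^{2j} u = u a^{2j}`. [folklore] -/
theorem pow_two_mul_comm_of_conj_eq_inv {a u : G} (hau : a * u * a⁻¹ = u⁻¹) (j : ℕ) :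
    a ^ (2 * j) * u = u * a ^ (2 * j) := by
  have h1 : a * u = u⁻¹ * a := by
    calc a * u = a * u * a⁻¹ * a := by rw [inv_mul_cancel_right]
      _ = u⁻¹ * a := by rw [hau]
  have h2 : a * u⁻¹ * a⁻¹ = u := by
    rw [show a * u⁻¹ * a⁻¹ = (a * u * a⁻¹)⁻¹ by group, hau, inv_inv]
  have h3 : a * u⁻¹ = u * a := by
    calc a * u⁻¹ = a * u⁻¹ * a⁻¹ * a := by rw [inv_mul_cancel_right]
      _ = u * a := by rw [h2]
  have hc : a ^ 2 * u = u * a ^ 2 := by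
    rw [pow_two, mul_assoc, h1, ← mul_assoc, h3, mul_assoc]
  rw [pow_mul]
  exact ((show Commute (a ^ 2) u from hc).pow_left j).eq

/-- `x u x⁻¹ = u ⟹ x u = u x`. [folklore] -/
theorem mul_comm_of_conj_eq {x u : G} (hxu : x * u * x⁻¹ = u) : x * u = u * x := by
  calc x * u = x * u * x⁻¹ * x := by group
    _ = u * x := by rw [hxu]

end GroupLemmas

variable {K : Type} [Field K] [NumberField K] [IsCMField K]

/-! ## §2 Shapes Q× and QK are BAD for `p ∈ {3, 5, 11, 13}` and for `p = 7` -/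

/-- **SHAPES Q× AND QK ARE BAD FOR `p ∈ {3, 5, 11, 13}`.**  `u, a, x ∈ Gal(K/ℚ)` with `ord u = p ∈ {3,5,11,13}`, `⟨u⟩ ◁ Gal`,
`ord a = 2ⁿ⁻¹` (`n ≥ 4`), `x a = a⁻¹ x`, `x² = a^{2ⁿ⁻²} = c`, `x u x⁻¹ = u` and `a u a⁻¹ = u^{±1}` ⟹ `K` carries a SIMPLE DEGENERATE CM
abelian variety of dimension `[K:ℚ]/2` with a rational `(p,p)` class outside the divisor ring on some power (the subgroup
`⟨a^{2ⁿ⁻³}, x⟩ × ⟨u⟩ ≅ Q₈ × C_p` through `c`). [cite: Shimura1998, §6.2 Thm. 3 and §8.2 Prop. 26]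
[cite: Gordon1999HodgeAVSurvey, Thm. 6.4 and §9.3] -/
theorem exists_simple_degenerate_of_shape_quaternion_of_prime_le_thirteen [IsGalois ℚ K] {p n : ℕ}
    (hp : p = 3 ∨ p = 5 ∨ p = 11 ∨ p = 13) (hn : 4 ≤ n) {u a x : K ≃ₐ[ℚ] K} (hu : orderOf u = p)
    (hnorm : (Subgroup.zpowers u).Normal) (ha : orderOf a = 2 ^ (n - 1)) (hxa : x * a = a⁻¹ * x)
    (hxx : x * x = a ^ 2 ^ (n - 2)) (hc : a ^ 2 ^ (n - 2) = (IsCMField.complexConj K).restrictScalars ℚ)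
    (hxu : x * u * x⁻¹ = u) (hau : a * u * a⁻¹ = u ∨ a * u * a⁻¹ = u⁻¹) :
    ∃ (Φ : CMType K) (φ₀ : K →+* ℂ) (A : AbelianVariety ℂ) (ι : 𝓞 K →+* End A)
      (θ : K →+* Module.End ℂ (complexBetti A.X 1)),
      IsPrimitive (ℂ ≃+* ℂ) Φ.1 φ₀ ∧ ¬ IsNondegenerate Φ ∧ IsCMTypeRealisation Φ A ι θ ∧ A.IsSimple ∧
      A.dim = Module.finrank ℚ K / 2 ∧
      ∃ n p : ℕ, ∃ x : complexBetti (⨁ fun _ : Fin n => A).X (2 * p), IsRationalClass x ∧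
        IsOfHodgeType (⨁ fun _ : Fin n => A).dim (⨁ fun _ : Fin n => A).X (2 * p) p p x ∧
        x ∉ divisorClassesSpan (⨁ fun _ : Fin n => A).X (⨁ fun _ : Fin n => A).dim p := by
  -- `A := a^{2ⁿ⁻³}` has order `4`, `A² = a^{2ⁿ⁻²} = c = x²`, `x A x⁻¹ = A⁻¹`, and `A, x` centralise `u`
  have h23 : 2 ^ (n - 3) * 2 = 2 ^ (n - 2) := by rw [← pow_succ]; congr 1; omega
  have hA : orderOf (a ^ 2 ^ (n - 3)) = 4 := by
    rw [orderOf_pow_of_dvd (pow_ne_zero _ two_ne_zero) (by rw [ha]; exact pow_dvd_pow 2 (by omega)), ha,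
      Nat.pow_div (by omega) two_pos]
    rw [show n - 1 - (n - 3) = 2 by omega]
    norm_num
  have hX : x * x = (a ^ 2 ^ (n - 3)) ^ 2 := by rw [hxx, ← pow_mul, h23]
  have hXA : x * a ^ 2 ^ (n - 3) * x⁻¹ = (a ^ 2 ^ (n - 3))⁻¹ := conj_pow_eq_inv_of_mul_eq hxa _
  have hc' : (a ^ 2 ^ (n - 3)) ^ 2 = (IsCMField.complexConj K).restrictScalars ℚ := by rw [← pow_mul, h23, hc]
  have hAu : a ^ 2 ^ (n - 3) * u = u * a ^ 2 ^ (n - 3) := by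
    rcases hau with hau | hau
    · exact ((show Commute a u from mul_comm_of_conj_eq hau).pow_left _).eq
    · have h24 : 2 ^ (n - 3) = 2 * 2 ^ (n - 4) := by rw [← pow_succ']; congr 1; omega
      rw [h24]
      exact pow_two_mul_comm_of_conj_eq_inv hau _
  have hXu : x * u = u * x := mul_comm_of_conj_eq hxu
  rcases hp with rfl | rfl | rfl | rfl
  · exact exists_simple_degenerate_of_quaternionEight_cyclicThree_subgroup hA hX hXA hc' hu hAu hXu hnorm
  · exact exists_simple_degenerate_of_quaternionEight_cyclicFive_subgroup hA hX hXA hc' hu hAu hXu hnorm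
  · exact exists_simple_degenerate_of_quaternionEight_cyclicEleven_subgroup hA hX hXA hc' hu hAu hXu hnorm
  · exact exists_simple_degenerate_of_quaternionEight_cyclicThirteen_subgroup hA hX hXA hc' hu hAu hXu hnorm

/-- **SHAPES Q× AND QK ARE BAD FOR `p = 7` (`n ≥ 5`)** — through the subgroup `⟨a^{2ⁿ⁻⁴}, x⟩ × ⟨u⟩ ≅ Q₁₆ × C₇` (`Q₈ × C₇` is
GOOD, so `Q₁₆` is needed; for Q× the case `n = 4` is `CorCM/GaloisQuaternionSixteenCyclicSevenDegenerate` itself).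
[cite: Shimura1998, §6.2 Thm. 3 and §8.2 Prop. 26] [cite: Gordon1999HodgeAVSurvey, Thm. 6.4 and §9.3] -/
theorem exists_simple_degenerate_of_shape_quaternion_seven [IsGalois ℚ K] {n : ℕ} (hn : 5 ≤ n) {u a x : K ≃ₐ[ℚ] K}
    (hu : orderOf u = 7) (hnorm : (Subgroup.zpowers u).Normal) (ha : orderOf a = 2 ^ (n - 1))
    (hxa : x * a = a⁻¹ * x) (hxx : x * x = a ^ 2 ^ (n - 2))
    (hc : a ^ 2 ^ (n - 2) = (IsCMField.complexConj K).restrictScalars ℚ) (hxu : x * u * x⁻¹ = u)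
    (hau : a * u * a⁻¹ = u ∨ a * u * a⁻¹ = u⁻¹) :
    ∃ (Φ : CMType K) (φ₀ : K →+* ℂ) (A : AbelianVariety ℂ) (ι : 𝓞 K →+* End A)
      (θ : K →+* Module.End ℂ (complexBetti A.X 1)),
      IsPrimitive (ℂ ≃+* ℂ) Φ.1 φ₀ ∧ ¬ IsNondegenerate Φ ∧ IsCMTypeRealisation Φ A ι θ ∧ A.IsSimple ∧
      A.dim = Module.finrank ℚ K / 2 ∧
      ∃ n p : ℕ, ∃ x : complexBetti (⨁ fun _ : Fin n => A).X (2 * p), IsRationalClass x ∧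
        IsOfHodgeType (⨁ fun _ : Fin n => A).dim (⨁ fun _ : Fin n => A).X (2 * p) p p x ∧
        x ∉ divisorClassesSpan (⨁ fun _ : Fin n => A).X (⨁ fun _ : Fin n => A).dim p := by
  have h24 : 2 ^ (n - 4) * 4 = 2 ^ (n - 2) := by
    rw [show (4 : ℕ) = 2 ^ 2 by norm_num, ← pow_add]; congr 1; omega
  have hA : orderOf (a ^ 2 ^ (n - 4)) = 8 := by
    rw [orderOf_pow_of_dvd (pow_ne_zero _ two_ne_zero) (by rw [ha]; exact pow_dvd_pow 2 (by omega)), ha,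
      Nat.pow_div (by omega) two_pos]
    rw [show n - 1 - (n - 4) = 3 by omega]
    norm_num
  have hX : x * x = (a ^ 2 ^ (n - 4)) ^ 4 := by rw [hxx, ← pow_mul, h24]
  have hXA : x * a ^ 2 ^ (n - 4) * x⁻¹ = (a ^ 2 ^ (n - 4))⁻¹ := conj_pow_eq_inv_of_mul_eq hxa _
  have hc' : (a ^ 2 ^ (n - 4)) ^ 4 = (IsCMField.complexConj K).restrictScalars ℚ := by rw [← pow_mul, h24, hc]
  have hAu : a ^ 2 ^ (n - 4) * u = u * a ^ 2 ^ (n - 4) := by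
    rcases hau with hau | hau
    · exact ((show Commute a u from mul_comm_of_conj_eq hau).pow_left _).eq
    · have h25 : 2 ^ (n - 4) = 2 * 2 ^ (n - 5) := by rw [← pow_succ']; congr 1; omega
      rw [h25]
      exact pow_two_mul_comm_of_conj_eq_inv hau _
  have hXu : x * u = u * x := mul_comm_of_conj_eq hxu
  exact exists_simple_degenerate_of_quaternionSixteen_cyclicSeven_subgroup hA hX hXA hc' hu hAu hXu hnorm

/-- **SHAPES Q× AND QK ARE BAD WHENEVER `Q₈ × C_p` CARRIES A BALANCED CERTIFICATE BALANCED OVER `C_p`** (any odd `p`,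
`n ≥ 4`): the reduction of the arithmetic of the shapes Q×, QK to the bottom member `Q₈ × C_p` of the tower.  `T₁ ⊆ Q₈ × C_p` a CM
set for `(a², 1)` with trivial left stabiliser, `D₁` balanced for `T₁`, moved by `(a²,1)`, with `(a²,1)`-invariant multiset of first
coordinates. [cite: Shimura1998, §6.2 Thm. 3 and §8.2 Prop. 26] [cite: Gordon1999HodgeAVSurvey, Thm. 6.4 and §9.3] -/
theorem exists_simple_degenerate_of_shape_quaternion_of_certificate [IsGalois ℚ K] {p n : ℕ} [NeZero p] (hp : Odd p)
    (hp1 : p ≠ 1) (hn : 4 ≤ n) {u a x : K ≃ₐ[ℚ] K} (hu : orderOf u = p) (hnorm : (Subgroup.zpowers u).Normal)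
    (ha : orderOf a = 2 ^ (n - 1)) (hxa : x * a = a⁻¹ * x) (hxx : x * x = a ^ 2 ^ (n - 2))
    (hc : a ^ 2 ^ (n - 2) = (IsCMField.complexConj K).restrictScalars ℚ) (hxu : x * u * x⁻¹ = u)
    (hau : a * u * a⁻¹ = u ∨ a * u * a⁻¹ = u⁻¹) (T₁ : Finset (QuaternionGroup 2 × Multiplicative (ZMod p)))
    (hcm₁ : ∀ y, y ∈ T₁ ↔ ((QuaternionGroup.a 2, 1) : QuaternionGroup 2 × Multiplicative (ZMod p)) * y ∉ T₁)
    (hprim₁ : ∀ v : QuaternionGroup 2 × Multiplicative (ZMod p), v ≠ 1 → ∃ w, ¬ (w ∈ T₁ ↔ v * w ∈ T₁))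
    (D₁ : Finset (QuaternionGroup 2 × Multiplicative (ZMod p)))
    (hbal₁ : ∀ g : QuaternionGroup 2 × Multiplicative (ZMod p), 2 * (D₁.filter fun y => y * g ∈ T₁).card = D₁.card)
    (hmov₁ : ∃ y ∈ D₁, ((QuaternionGroup.a 2, 1) : QuaternionGroup 2 × Multiplicative (ZMod p)) * y ∉ D₁)
    (hsym₁ : D₁.val.map Prod.fst =
      (D₁.val.map fun y => ((QuaternionGroup.a 2, 1) : QuaternionGroup 2 × Multiplicative (ZMod p)) * y).map Prod.fst) :
    ∃ (Φ : CMType K) (φ₀ : K →+* ℂ) (A : AbelianVariety ℂ) (ι : 𝓞 K →+* End A)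
      (θ : K →+* Module.End ℂ (complexBetti A.X 1)),
      IsPrimitive (ℂ ≃+* ℂ) Φ.1 φ₀ ∧ ¬ IsNondegenerate Φ ∧ IsCMTypeRealisation Φ A ι θ ∧ A.IsSimple ∧
      A.dim = Module.finrank ℚ K / 2 ∧
      ∃ n p : ℕ, ∃ x : complexBetti (⨁ fun _ : Fin n => A).X (2 * p), IsRationalClass x ∧
        IsOfHodgeType (⨁ fun _ : Fin n => A).dim (⨁ fun _ : Fin n => A).X (2 * p) p p x ∧
        x ∉ divisorClassesSpan (⨁ fun _ : Fin n => A).X (⨁ fun _ : Fin n => A).dim p := by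
  have h23 : 2 ^ (n - 3) * 2 = 2 ^ (n - 2) := by rw [← pow_succ]; congr 1; omega
  have hA : orderOf (a ^ 2 ^ (n - 3)) = 2 * 2 := by
    rw [orderOf_pow_of_dvd (pow_ne_zero _ two_ne_zero) (by rw [ha]; exact pow_dvd_pow 2 (by omega)), ha,
      Nat.pow_div (by omega) two_pos]
    rw [show n - 1 - (n - 3) = 2 by omega]
    norm_num
  have hX : x * x = (a ^ 2 ^ (n - 3)) ^ 2 := by rw [hxx, ← pow_mul, h23]
  have hXA : x * a ^ 2 ^ (n - 3) * x⁻¹ = (a ^ 2 ^ (n - 3))⁻¹ := conj_pow_eq_inv_of_mul_eq hxa _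
  have hc' : (a ^ 2 ^ (n - 3)) ^ 2 = (IsCMField.complexConj K).restrictScalars ℚ := by rw [← pow_mul, h23, hc]
  have hAu : a ^ 2 ^ (n - 3) * u = u * a ^ 2 ^ (n - 3) := by
    rcases hau with hau | hau
    · exact ((show Commute a u from mul_comm_of_conj_eq hau).pow_left _).eq
    · have h24 : 2 ^ (n - 3) = 2 * 2 ^ (n - 4) := by rw [← pow_succ']; congr 1; omega
      rw [h24]
      exact pow_two_mul_comm_of_conj_eq_inv hau _
  have hXu : x * u = u * x := mul_comm_of_conj_eq hxu
  have hcop : Nat.Coprime (4 * 2) p := by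
    rw [show 4 * 2 = 2 ^ 3 by norm_num]
    exact Nat.Coprime.pow_left 3 (Nat.coprime_two_left.mpr hp)
  exact exists_simple_degenerate_of_quaternion_cyclic_certificate (m := 2) le_rfl hp hp1 hcop hA hX hXA hc' hu hAu hXu hnorm
    T₁ hcm₁ hprim₁ D₁ hbal₁ hmov₁ hsym₁

/-! ## §3 The classification for degrees `2ⁿ·p`, `p ∈ {3, 5, 7, 11, 13}`, `n ≥ 5` -/

/-- **GOOD GALOIS CM FIELDS OF DEGREE `2ⁿ·p`, `p ∈ {3,5,7,11,13}`, `n ≥ 5`: SHAPE C(r) OR Dic.**  If every primitive CM type of `K`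
is nondegenerate then complex conjugation is the unique involution of `Gal(K/ℚ)` and for every Sylow `2`-subgroup `S`
(of order `2ⁿ`): EITHER `S = ⟨x⟩` is cyclic, `Gal = ⟨u⟩⟨x⟩` with `ord u = p`, `⟨u⟩ ◁ Gal`, `x u x⁻¹ = uʳ` (shape C(r)), OR `S = ⟨a, x⟩` is
generalised quaternion (`ord a = 2ⁿ⁻¹`, `x a = a⁻¹ x`, `x² = a^{2ⁿ⁻²}`) with `a u a⁻¹ = u` and `x u x⁻¹ = u⁻¹` (shape Dic) — the shapes
Q× and QK of gen 38 do not occur. [cite: Shimura1998, §8.2 Prop. 26 and §32.10] [cite: Dodson1984, §3.1.1, §4.1 and §5]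
[cite: Rotman1995, Thm. 4.12, Thm. 5.46 and Thm. 7.41] -/
theorem structure_of_forall_isNondegenerate_of_thirtytwo_dvd_of_prime_le_thirteen [IsGalois ℚ K] {n p : ℕ}
    (hp : p = 3 ∨ p = 5 ∨ p = 7 ∨ p = 11 ∨ p = 13) (hdeg : Module.finrank ℚ K = 2 ^ n * p) (hn : 5 ≤ n)
    (hgood : ∀ (Φ : CMType K) (φ : K →+* ℂ), IsPrimitive (ℂ ≃+* ℂ) Φ.1 φ → IsNondegenerate Φ) [Fact (Nat.Prime 2)] :
    (∀ σ : K ≃ₐ[ℚ] K, σ * σ = 1 → σ ≠ 1 → σ = (IsCMField.complexConj K).restrictScalars ℚ) ∧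
      ∀ S : Sylow 2 (K ≃ₐ[ℚ] K), Nat.card (S : Subgroup (K ≃ₐ[ℚ] K)) = 2 ^ n ∧
        ((∃ u x : K ≃ₐ[ℚ] K, orderOf u = p ∧ (Subgroup.zpowers u).Normal ∧ orderOf x = 2 ^ n ∧
            Subgroup.zpowers x = (S : Subgroup (K ≃ₐ[ℚ] K)) ∧ (∀ g : K ≃ₐ[ℚ] K, ∃ j i : ℕ, g = u ^ j * x ^ i) ∧
            ∃ r : ℕ, x * u * x⁻¹ = u ^ r) ∨
         (∃ u a x : K ≃ₐ[ℚ] K, orderOf u = p ∧ (Subgroup.zpowers u).Normal ∧ orderOf a = 2 ^ (n - 1) ∧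
            a ∈ (S : Subgroup (K ≃ₐ[ℚ] K)) ∧ x ∈ (S : Subgroup (K ≃ₐ[ℚ] K)) ∧ x ∉ Subgroup.zpowers a ∧ x * a = a⁻¹ * x ∧
            x * x = a ^ 2 ^ (n - 2) ∧ (∀ g : K ≃ₐ[ℚ] K, ∃ j i : ℕ, g = u ^ j * a ^ i ∨ g = u ^ j * (x * a ^ i)) ∧
            a * u * a⁻¹ = u ∧ x * u * x⁻¹ = u⁻¹)) := by
  have hpodd : Odd p := by rcases hp with rfl | rfl | rfl | rfl | rfl <;> decide
  have hp1 : p ≠ 1 := by rcases hp with rfl | rfl | rfl | rfl | rfl <;> decide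
  rcases structure_of_forall_isNondegenerate_of_thirtytwo_dvd hdeg hpodd hn hgood with ⟨hM1, -⟩ | ⟨-, hinv, hS⟩
  · exact absurd hM1 hp1
  refine ⟨hinv, fun S => ?_⟩
  obtain ⟨hcardS, hshape⟩ := hS S
  refine ⟨hcardS, ?_⟩
  rcases hshape with hcyc | ⟨u, a, x, hu, hnorm, ha, haS, hxS, hxa', hxa, hxx, hgen, hshapes⟩
  · exact Or.inl hcyc
  right
  -- complex conjugation is `a^{2ⁿ⁻²}` (the unique involution)
  have hc : a ^ 2 ^ (n - 2) = (IsCMField.complexConj K).restrictScalars ℚ := by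
    refine hinv _ ?_ ?_
    · rw [← pow_add, ← two_mul, ← pow_succ', show n - 2 + 1 = n - 1 by omega, ← ha, pow_orderOf_eq_one]
    · exact pow_ne_one_of_lt_orderOf (pow_ne_zero _ two_ne_zero) (by rw [ha]; exact Nat.pow_lt_pow_right (by norm_num) (by omega))
  -- the shapes Q× and QK are BAD
  have hbad : (a * u * a⁻¹ = u ∨ a * u * a⁻¹ = u⁻¹) → x * u * x⁻¹ = u → False := fun hau hxu => by
    rcases hp with rfl | rfl | h7 | rfl | rfl
    · obtain ⟨Φ, φ₀, -, -, -, hprim, hdeg', -⟩ :=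
        exists_simple_degenerate_of_shape_quaternion_of_prime_le_thirteen (Or.inl rfl) (by omega) hu hnorm ha hxa hxx hc hxu hau
      exact hdeg' (hgood Φ φ₀ hprim)
    · obtain ⟨Φ, φ₀, -, -, -, hprim, hdeg', -⟩ :=
        exists_simple_degenerate_of_shape_quaternion_of_prime_le_thirteen (Or.inr (Or.inl rfl)) (by omega) hu hnorm ha hxa hxx
          hc hxu hau
      exact hdeg' (hgood Φ φ₀ hprim)
    · subst h7
      obtain ⟨Φ, φ₀, -, -, -, hprim, hdeg', -⟩ :=
        exists_simple_degenerate_of_shape_quaternion_seven hn hu hnorm ha hxa hxx hc hxu hau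
      exact hdeg' (hgood Φ φ₀ hprim)
    · obtain ⟨Φ, φ₀, -, -, -, hprim, hdeg', -⟩ :=
        exists_simple_degenerate_of_shape_quaternion_of_prime_le_thirteen (Or.inr (Or.inr (Or.inl rfl))) (by omega) hu hnorm
          ha hxa hxx hc hxu hau
      exact hdeg' (hgood Φ φ₀ hprim)
    · obtain ⟨Φ, φ₀, -, -, -, hprim, hdeg', -⟩ :=
        exists_simple_degenerate_of_shape_quaternion_of_prime_le_thirteen (Or.inr (Or.inr (Or.inr rfl))) (by omega) hu hnorm
          ha hxa hxx hc hxu hau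
      exact hdeg' (hgood Φ φ₀ hprim)
  rcases hshapes with ⟨hau, hxu⟩ | hdic | ⟨hau, hxu⟩
  · exact (hbad (Or.inl hau) hxu).elim
  · exact ⟨u, a, x, hu, hnorm, ha, haS, hxS, hxa', hxa, hxx, hgen, hdic⟩
  · exact (hbad (Or.inr hau) hxu).elim

end Summit.HodgeConjecture.CorCM.GaloisModels

end
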